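import Literature.MathematicalPhysics.QuantumFieldTheory.Balaban1983to89.Node00.Record12BgRowCoClassGaugeRGuardedBRowAllTorusLam
import Summits.QuantumFields.YangMills.Theorems.BalabanUVNodesN07Thm1Top7FromProp8GuardedB

/-!
# K0⁷ — THE FOUR-CONJUNCT CANDIDATE GUARD `A‴(c, c₀, c₁)` IS MET BY THE K0 BODY AT `θ₁₅ᶜᶜᴹᵂ(j; γ)` OVER PRINT's [4] (2.3) DATUM — №365 SIBLING `…K0Stub1GridNumericsGuardWitnessB` of
# `…K0Stub1GridNumericsGuardWitness` §2–§3 (row P11 at the Co carrier and the ⁵∕⁷ closers under it; the located arithmetic §0–§1 stays in the parent)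

Cell `pub-ymgap`, seat `pub-ymgap-k0-s1-w2` generation 7 (K0⁷ `stmt-QuantumFields-20541` helper lane; `--kind proof --supports stmt-QuantumFields-20541 --as helper`; count-neutral).
NEW additive module, theorems only (0 `def`, 0 `sorry`); nothing in the tree is modified.  Parent text: `…K0Stub1GridNumericsGuardWitness` (seat `pub-ymgap-k0-s1-w3` g8).
[15] = [Balaban1985Variational]; [6] = [Balaban1985RegularSpaces]; [III] = [Balaban1988Convergent]; [I] = [Balaban1987RG1]; [4] = [Balaban1984PropagatorsII] ((2.1) blocks, (2.3) the `Λ`-datum).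

WHY A SIBLING (director-ym №365, 2026-08-30; gate8 R558 «RENAME-AND-REDIRECT»; (E1) variant (iii-b) of record; FLAG №16 ∕ LOCATE-HSEAM 5d3298b8d191f169).  After the seam edit of
`Node00/Record13CoP`, `UbgOfRecord₁₃CoP … (n+1)` IS node00-def-R's print-datum background `UbgMSCoPOfRecordB …` ([4] (2.3) `Λ`-fibre; `UbgOfRecord₁₃CoP_succ`, `rfl`), so the parent's
ONE seam reader (§2's `rw [UbgOfRecord₁₃CoP_succ]`) must read the two [15] sentences over `(lamDatum F, Dat)`; `Summits/…/Theorems/` statements are immutable (`theorems.append-only`), hence THIS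
sibling: the parent's §2–§3 under the SAME short names in the NEW namespace `…K0Stub1GridNumericsGuardWitnessB`, `VariationalThm1RegSepCoP7MG ∕ …GaugeRegSepCoP7MG ∕ Gauge9RegSepTopStepG ∕
Prop8RegSepTopStepG … A‴ …` ↦ the ᴮ tokens `…GB … A‴ (lamDatum F) Dat …` (S1a-C ∕ S1b-2 ∕ S1b-1 ∕ F0c), the data predicate a PARAMETER `Dat : TopData F N` with the (7) transfer `hDat`
DISPLAYED (k0-s1-w1's `…GuardedZBLam` convention), the all-torus lift := k0-s1-w1's leaf `Node00/…GaugeRGuardedBRowAllTorusLam` (✓p767852) BY NAME, the (8)-bridge 53′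
`variationalThm1RegSepCoP7MGB_of_prop8TopStepGB_lamDatum`, the level letter inlined; conclusions byte-identical to the parent's.  THE SEAM ITSELF IS DISPLAYED (k0-s1-w1's
`…GuardedZBLam` shape — green on both sides of the seam edit, files as an ordinary NEW leaf): every theorem carries `hseam : ∀ θ p n s W, UbgOfRecord₁₃CoP F N θ p (n+1) s W = UbgMSCoPOfRecordB …`
right after `hDat` — BEFORE the seam edit NOT provable and NOT claimed; AFTER it `fun θ p n s W => by rw [UbgOfRecord₁₃CoP_succ]`.  NOT carried (№365: no copies of landed statements): the
parent's §0–§1 (`exists_v20G_guarded_prefix_unit_blocks ∕ _wrapping_blocks`, `not_dvd_of_mul_eq_one`, `hgran_of_pow_dvd`, `mul_pow_dvd_pow_of_succ_le` — datum-free located arithmetic,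
statements unchanged).  The parent module is NOT touched (residue after the seam: red — unbuildable, NOT false; R556 attic later).

WHY (LOCATED-STUB1-GRID-NUMERICS, cell bus 2026-08-28 15:11Z, for the lane owner dag-n07-e ∕ the plan ∕ a referee to confirm — NOT a ruling, NOT a registration).
The registered V20-G stub-1 text (`K0V20GDefs.Prop8StepCoPGAt F`, skeleton dead8a8df885c226) guards [15] Prop. 8's top step (`Node00.Prop8RegSepTopStepG F 2 suppDom Adm B₃ a₀ a₁`,
`Node00/CriticalOnFibreTopGuarded` :108) by the CONCRETE two-letter guard `Adm := fun ν _M _g K k _s => c ≤ ν.M₁ ∧ k + c₀ ≤ F.m + K`; the sentence's prefix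
`∀ (ν : Stage7Numerics) (M : ℕ) (g : ℕ → ℝ) (K k : ℕ) (s : SeqOfRecord F ν M g K k), Sect2.SeqSeparated ν.M₁ s → 0 < ν.M₁ → Adm ν M g K k s → 1 ≤ k → …` leaves the
record's basic-cube letter `M` and its coupling history `g` (hence `R_j = RkOfRecord L ν.r (g j)`, [III] (2.5)) FREE, and the guard ignores them.  The record-side suppliers of
road R0′ through which the S6 head's `HCHART` (dag-n07-w4 FILE 7 `…N07SplitClauseHeadKnitRanged` :238–239, same prefix) is to be discharged DISPLAY the record's GRID NUMERICS
`hdiv : ∀ j, 1 ≤ j → j ≤ k → dCubeSide (F.P K).L M (RkOfRecord (F.P K).L ν.r (g j)) j ∣ (F.P K).sitesPerDir 0` (torus-compatible `𝐃_j`-partitions) and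
`hgran : ∀ j, 1 ≤ j → j ≤ k → M₁ ∣ M * RkOfRecord (F.P K).L ν.r (g j)` (the [4] (2.1) block structure of `Ω_j(s)` at the `H`-expansion granularity `M₁ := L·M_h ≥ L·M_h⁰`):
dag-n07-w6 `…N07RecordDomainsAdm22` (p618589) `adm22_domainsOfSeq_seqOfRecord` ∕ `adm22_meet_domainsOfSeq_seqOfRecord` :329–346 (the OUTWARD-MEET family `D″` that the lane
owner's ROAD WORD g22 marks REQUIRED), `inOm_domainsOfSeq_seqOfRecord_iff` :357, k0-s1-w1 `…K0Stub1FlatAveragingDictionaryLevelsAtRecord` (p621779) :52.  §0 shows — in the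
kernel — that under the registered guard there are prefix letters `(ν, M, g)` with `M·R_j = 1` at every `j` (so `hgran` FAILS at every granularity `≥ 2`, in particular at every
`L·M_h`, `F.L > 11`) and prefix letters with `L^j·M·R_j > sitesPerDir 0` (so `hdiv` FAILS): the two rows are not merely unproved but UNDERIVABLE from the V20-G prefix.  Print
never meets such records: [III] (2.1) p. 254, (2.5) p. 255, p. 257 take `M`, `R_j` powers of `L` with «partitions compatible with all other partitions», and [6] (1.3) p. 77
(«Ω_j is a sum of cubes of size M₁Lʲη») is the block-structure HALF of print's admissibility — the tree's `Sect2.SeqSeparated` encodes only the separation half (1.6) (its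
docstring, `Node00/Record12BgRowAnalysis` :455–462, records exactly this range difference).  Same CLASS as the two located defects the V20 text already repaired
(LOCATED-STUB1-FLOOR: `c ≤ ν.M₁`; LOCATED-UNGUARDED-LEVELS: `k + c₀ ≤ F.m + K`), on the two prefix letters the guard still ignores.
§1–§2 show that the MINIMAL REPAIR CANDIDATE — two more conjuncts `F.L ^ c₁ ∣ M ∧ (∀ i, 1 ≤ i → i ≤ k → dCubeSide (F.P K).L M (RkOfRecord (F.P K).L ν.r (g i)) i ∣
(F.P K).sitesPerDir 0)` with `c₁` OUTERMOST next to `c c₀` — (§1) supplies p618589's `hgran` at every granularity `L·M_h ∣ F.L^{c₁}` (the stub's prover picks `c₁ := a′ + 1`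
for its `M_h = L^{a′}`) and `hdiv` verbatim, and (§2) is MET BY THE K0 BODY at the witness `θ₁₅ᶜᶜᴹᵂ(j; γ)` with ZERO new analysis: the fourth conjunct at the body's
instantiation `(ν, M, g, K, k) := (θ.ν, θ.τ9.M, gOfRecord₁₃ θ p, p.K, n)` IS `PartCompat₁₃ F N θ p n` (`Node00/Record13` :1238–1239), which the body's `hAdm` binder (this
lineage's p635083 §1 :116–117) already receives; the third is `theta13OfThm1CCMW_τ9_M : τ9.M = F.L ^ j` with `c₁ ≤ j` — so p635083 §1's all-torus lift runs unchanged and the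
row P11 + the ⁵∕⁷ closers follow under the candidate guard exactly as p635083 §2–§3 do under V20-G (proofs = theirs with two more `hAdm` goals).  The plan words any V21
(director-ym №219 (2): a located defect of a registered stub text → referee → plan); NOTHING here registers, replaces or votes on a text.

WHAT IS PROVED HERE (sorry-free; 0 `def`; axioms standard; the parent's §0–§1 located arithmetic is NOT repeated — it stays in the parent).  §2 ★★
`bgSepCoPAt_theta13OfThm1CCMW_gridGuard_of_thm1RegSepCoP7MG_of_thm1GaugeG_of_hcomp_allTorus` · §3 `exists_k0SepCoP_thm1CCMW_gridGuard_…` · `exists_k0SepCoPH_thm1CCMW_gridGuard_…` · ★★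
`exists_k0SepCoPH_thm1CCMW_gridGuard_of_thm1RegSepCoP7MG_of_gauge9TopStepG_of_hcomp_allTorus` · `…_of_prop8TopStepG_…` — all over `(lamDatum F, Dat)` with `hDat` displayed.
HONEST FRAMING: count-neutral kernel re-keying BY NAME; CONDITIONAL on `hseam` (the Stage-2 seam — NOT in the tree at filing time) and `hDat`; every [15]∕[6]∕[I] sentence is a HYPOTHESIS (a `Prop`, never asserted, inhabited nowhere here); the
compositions are CONDITIONAL; the candidate guard is NOT a registered text; `stub_prop8StepCoPG13` ∕ K0⁷ ∕ K1⁹ NOT closed; N07 NOT discharged; counts unmoved (typed 28∕28 ·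
discharged 8∕28); the route closes only the conditional finite-𝕋⁴ rung `BalabanLadder.UV` — the YM mass gap (Clay) is NOT proved by any of this; nothing continuum ∕ ℝ⁴ ∕ OS; a sibling re-text is NOT progress by itself.
No `sorry`, `def`, `instance`, `notation`.
-/

noncomputable section

open MeasureTheory
open scoped Matrix.Norms.L2Operator

namespace Summit.QuantumFields.YangMills.Theorems.K0Stub1GridNumericsGuardWitnessB

open Literature.MathematicalPhysics.QuantumFieldTheory.Balaban1983to89
open Literature.MathematicalPhysics.QuantumFieldTheory.Balaban1983to89.Node00
open Literature.MathematicalPhysics.QuantumFieldTheory.Balaban1983to89.T4Continuum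
open Literature.MathematicalPhysics.QuantumFieldTheory.Balaban1983to89.FlowStep
open Literature.MathematicalPhysics.QuantumFieldTheory.Balaban1983to89.FlowStepRuns
open Literature.MathematicalPhysics.QuantumFieldTheory.Balaban1983to89.B14.Eq218Concrete
open Literature.MathematicalPhysics.QuantumFieldTheory.Balaban1983to89.B15DeterminingSets
open Literature.MathematicalPhysics.QuantumFieldTheory.Balaban1983to89.B12RegularSpaces111
open Literature.MathematicalPhysics.QuantumFieldTheory.Balaban1983to89.B14RegularSpaces234
open Summit.QuantumFields.YangMills.BalabanUVNodes.N07Thm1Top7FromProp8GuardedB (variationalThm1RegSepCoP7MGB_of_prop8TopStepGB_lamDatum)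

/-! ## §2  ★★ The four-conjunct CANDIDATE guard is MET by the K0 body at `θ₁₅ᶜᶜᴹᵂ(j; γ)` (`c ≤ L^j`, `c₀ ≤ j + 1`, `c₁ ≤ j`): row P11 and the ⁵∕⁷ closers under it -/

section AtWitnessGridGuard

variable {F : T4Family} {N : ℕ} [NeZero N] {Dat : TopData F N} {j c c₀ c₁ : ℕ} {γ ε₀ ε₂₉ B₃ B₃' a₀ a₁ : ℝ}

/-- **★★ THE (7)-GUARDED SEPARATED ROW P11 AT THE Co CARRIER AT `θ₁₅ᶜᶜᴹᵂ(j; γ)` UNDER THE FOUR-CONJUNCT CANDIDATE GUARD**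
`Adm := fun ν M g K k _ => c ≤ ν.M₁ ∧ k + c₀ ≤ F.m + K ∧ F.L ^ c₁ ∣ M ∧ ∀ i, 1 ≤ i → i ≤ k → dCubeSide (F.P K).L M (RkOfRecord (F.P K).L ν.r (g i)) i ∣ (F.P K).sitesPerDir 0`
with `c ≤ L^j`, `c₀ ≤ j + 1`, `c₁ ≤ j`, THE TWO [15] SENTENCES READ OVER `(lamDatum F, Dat)` AND THE (7) TRANSFER `hDat` (№365 sibling) — p635083 §2 VERBATIM but for the guard:
k0-s1-w1's all-torus lift `Stage13Params.bgAtDatumCoPB_of_thm1RegSepCoP7MGB_of_thm1GaugeGB_allTorus` (guard- and `Dat`-generic, outer `hAdm`; at `UbgMSCoPOfRecordB` = `UbgOfRecord₁₃CoP … (n+1)`,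
`UbgOfRecord₁₃CoP_succ`) with `hAdm` DISCHARGED at every torus-compatible run of the window by: the floor (`ν.M₁ = L^j ≥ c`), the level letter (p635083 §0, inlined: `n + j + 1 ≤ F.m + p.K`), the cube letter `τ9.M = L^j` (`L^{c₁} ∣ L^j`),
and `PartCompat₁₃ F N θ p n` ITSELF (the fourth conjunct at `(θ.ν, θ.τ9.M, gOfRecord₁₃ θ p, p.K, n)`, by `rfl`).  CONDITIONAL on the two [15] sentences; nothing asserted.
[cite: Balaban1985Variational, (6)–(7) p.278, Thm 1 (8)–(9) p.279, (144)–(152) pp.300–301, Prop. 8 p.304, p.304 lines 1–2; Balaban1985RegularSpaces, (1.3)–(1.9) p.77; Balaban1988Convergent, Thm 1 p.262, (2.1) p.254, (2.4)–(2.8) pp.255–256, (2.12)–(2.13) pp.256–257, (2.17)–(2.18) p.257, (2.25)–(2.28) pp.258–259; Balaban1987RG1, Thm 1 p.259, (0.1) p.251, (1.12) p.262] -/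
theorem bgSepCoPAt_theta13OfThm1CCMW_gridGuard_of_thm1RegSepCoP7MG_of_thm1GaugeG_of_hcomp_allTorus (hγ0 : 0 < γ) (hγ : γ ≤ 1 / 2) (hε : 0 < ε₀) (hε' : 0 < ε₂₉) (hB : 0 ≤ B₃) (hB' : 0 ≤ B₃')
    (ha₀ : 0 < a₀) (ha₁ : 0 < a₁) (hc : c ≤ F.L ^ j) (hc₀ : c₀ ≤ j + 1) (hc₁ : c₁ ≤ j)
    (h15 : VariationalThm1RegSepCoP7MGB F N (fun ν M g K k _s => c ≤ ν.M₁ ∧ k + c₀ ≤ F.m + K ∧ F.L ^ c₁ ∣ M ∧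
      ∀ i, 1 ≤ i → i ≤ k → dCubeSide (F.P K).L M (RkOfRecord (F.P K).L ν.r (g i)) i ∣ (F.P K).sitesPerDir 0) (lamDatum F) Dat B₃ a₀ a₁)
    (h15G : VariationalThm1GaugeRegSepCoP7MGB F N (F.L ^ j) (fun ν M g K k _s => c ≤ ν.M₁ ∧ k + c₀ ≤ F.m + K ∧ F.L ^ c₁ ∣ M ∧
      ∀ i, 1 ≤ i → i ≤ k → dCubeSide (F.P K).L M (RkOfRecord (F.P K).L ν.r (g i)) i ∣ (F.P K).sitesPerDir 0) (lamDatum F) Dat B₃ B₃' a₀ a₁)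
    (hDat : ∀ (θ : Stage13Params F N) (p : B12.RunParams) (n : ℕ) (s : SeqOfRecord F θ.ν θ.τ9.M (gOfRecord₁₃ F N θ p) p.K n) (δ : ℕ → ℝ) (W : MSField (F.P p.K) (SU N)), n ≤ p.K → PartCompat₁₃ F N θ p n →
      Sect2.DataSmall7PTop (avOfRecord F N p.K) s.Ω (suppDomOfRecord F θ.ν p.K s.Ω) n δ W → Dat p.K s.Ω (suppDomOfRecord F θ.ν p.K s.Ω) n δ W)
    (hseam : ∀ (θ : Stage13Params F N) (p : B12.RunParams) (n : ℕ) (s : SeqOfRecord F θ.ν θ.τ9.M (gOfRecord₁₃ F N θ p) p.K (n + 1)) (W : MSField (F.P p.K) (SU N)),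
      UbgOfRecord₁₃CoP F N θ p (n + 1) s W = UbgMSCoPOfRecordB F N θ.ν θ.τ9.M (gOfRecord₁₃ F N θ p) p.K (n + 1) s W)
    (hcomp : ∀ (p : B12.RunParams) (n : ℕ), n ≤ p.K → Step.InInterval (theta13OfThm1CCMW F N j γ ε₀ ε₂₉ B₃ B₃' a₀ a₁).γ n (gOfRecord₁₃ F N (theta13OfThm1CCMW F N j γ ε₀ ε₂₉ B₃ B₃' a₀ a₁) p) → ∀ m, m < n →
      (theta13OfThm1CCMW F N j γ ε₀ ε₂₉ B₃ B₃' a₀ a₁).s2.cR * epsOfRecord (theta13OfThm1CCMW F N j γ ε₀ ε₂₉ B₃ B₃' a₀ a₁).ν (gOfRecord₁₃ F N (theta13OfThm1CCMW F N j γ ε₀ ε₂₉ B₃ B₃' a₀ a₁) p) m ≤ 2 * ((theta13OfThm1CCMW F N j γ ε₀ ε₂₉ B₃ B₃' a₀ a₁).s2.cR * epsOfRecord (theta13OfThm1CCMW F N j γ ε₀ ε₂₉ B₃ B₃' a₀ a₁).ν (gOfRecord₁₃ F N (theta13OfThm1CCMW F N j γ ε₀ ε₂₉ B₃ B₃' a₀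 a₁) p) (m + 1)))
    (hcompRev : ∀ (p : B12.RunParams) (n : ℕ), n ≤ p.K → Step.InInterval (theta13OfThm1CCMW F N j γ ε₀ ε₂₉ B₃ B₃' a₀ a₁).γ n (gOfRecord₁₃ F N (theta13OfThm1CCMW F N j γ ε₀ ε₂₉ B₃ B₃' a₀ a₁) p) → ∀ m, m < n →
      (theta13OfThm1CCMW F N j γ ε₀ ε₂₉ B₃ B₃' a₀ a₁).s2.cR * epsOfRecord (theta13OfThm1CCMW F N j γ ε₀ ε₂₉ B₃ B₃' a₀ a₁).ν (gOfRecord₁₃ F N (theta13OfThm1CCMW F N j γ ε₀ ε₂₉ B₃ B₃' a₀ a₁) p) (m + 1) ≤ 2 * ((theta13OfThm1CCMW F N j γ ε₀ ε₂₉ B₃ B₃' a₀ a₁).s2.cR * epsOfRecord (theta13OfThm1CCMW F N j γ ε₀ ε₂₉ B₃ B₃' a₀ a₁).ν (gOfRecord₁₃ F N (theta13OfThm1CCMW F N j γ ε₀ ε₂₉ B₃ B₃' a₀ a₁) p) m)) :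
    ∀ (p : B12.RunParams) (n : ℕ), n ≤ p.K → Step.InInterval (theta13OfThm1CCMW F N j γ ε₀ ε₂₉ B₃ B₃' a₀ a₁).γ n (gOfRecord₁₃ F N (theta13OfThm1CCMW F N j γ ε₀ ε₂₉ B₃ B₃' a₀ a₁) p) → PartCompat₁₃ F N (theta13OfThm1CCMW F N j γ ε₀ ε₂₉ B₃ B₃' a₀ a₁) p n →
      ∀ s : SeqOfRecord F (theta13OfThm1CCMW F N j γ ε₀ ε₂₉ B₃ B₃' a₀ a₁).ν (theta13OfThm1CCMW F N j γ ε₀ ε₂₉ B₃ B₃' a₀ a₁).τ9.M (gOfRecord₁₃ F N (theta13OfThm1CCMW F N j γ ε₀ ε₂₉ B₃ B₃' a₀ a₁) p) p.K n, Sect2.SeqSeparated (theta13OfThm1CCMW F N j γ ε₀ ε₂₉ B₃ B₃' a₀ a₁).ν.M₁ s →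
      ∀ W : MSField (F.P p.K) (SU N), W ∈ suppOfRecord₁₃P F N (theta13OfThm1CCMW F N j γ ε₀ ε₂₉ B₃ B₃' a₀ a₁) p n s →
      Sect2.DataSmall7PTop (avOfRecord F N p.K) s.Ω (suppDomOfRecord F (theta13OfThm1CCMW F N j γ ε₀ ε₂₉ B₃ B₃' a₀ a₁).ν p.K s.Ω) n (fun j' => (theta13OfThm1CCMW F N j γ ε₀ ε₂₉ B₃ B₃' a₀ a₁).s2.cR * epsOfRecord (theta13OfThm1CCMW F N j γ ε₀ ε₂₉ B₃ B₃' a₀ a₁).ν (gOfRecord₁₃ F N (theta13OfThm1CCMW F N j γ ε₀ ε₂₉ B₃ B₃' a₀ a₁) p) j') W →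
      ∀ j', 1 ≤ j' → j' ≤ n → ∀ X : (Sect2.domSys (F.P p.K) (theta13OfThm1CCMW F N j γ ε₀ ε₂₉ B₃ B₃' a₀ a₁).τ9.M j').Dom,
      (Sect2.domSites (F.P p.K) (theta13OfThm1CCMW F N j γ ε₀ ε₂₉ B₃ B₃' a₀ a₁).τ9.M j' X ⊆ s.Λ j' →
        Sect2.ofBackgroundC (settingOfRecord₁₃ F N (theta13OfThm1CCMW F N j γ ε₀ ε₂₉ B₃ B₃' a₀ a₁) p).ι (UbgOfRecord₁₃CoP F N (theta13OfThm1CCMW F N j γ ε₀ ε₂₉ B₃ B₃' a₀ a₁) p n s W) ∈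
          Sect2.spaceI (settingOfRecord₁₃ F N (theta13OfThm1CCMW F N j γ ε₀ ε₂₉ B₃ B₃' a₀ a₁) p) ((theta13OfThm1CCMW F N j γ ε₀ ε₂₉ B₃ B₃' a₀ a₁).Rz p.K) (theta13OfThm1CCMW F N j γ ε₀ ε₂₉ B₃ B₃' a₀ a₁).τ9.M j' (Sect2.domSites (F.P p.K) (theta13OfThm1CCMW F N j γ ε₀ ε₂₉ B₃ B₃' a₀ a₁).τ9.M j' X)
            ((settingOfRecord₁₃ F N (theta13OfThm1CCMW F N j γ ε₀ ε₂₉ B₃ B₃' a₀ a₁) p).lf.alpha0 ((settingOfRecord₁₃ F N (theta13OfThm1CCMW F N j γ ε₀ ε₂₉ B₃ B₃' a₀ a₁) p).flow.g j')) ((settingOfRecord₁₃ F N (theta13OfThm1CCMW F N j γ ε₀ ε₂₉ B₃ B₃' a₀ a₁) p).lf.alpha1 ((settingOfRecord₁₃ F N (theta13OfThm1CCMW F N j γ ε₀ ε₂₉ B₃ B₃' a₀ a₁) p).flow.g j'))) ∧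
      (Sect2.admB (F.P p.K) (theta13OfThm1CCMW F N j γ ε₀ ε₂₉ B₃ B₃' a₀ a₁).ν (theta13OfThm1CCMW F N j γ ε₀ ε₂₉ B₃ B₃' a₀ a₁).τ9.M (gOfRecord₁₃ F N (theta13OfThm1CCMW F N j γ ε₀ ε₂₉ B₃ B₃' a₀ a₁) p) s.Ω s.Λ j' (Sect2.domSites (F.P p.K) (theta13OfThm1CCMW F N j γ ε₀ ε₂₉ B₃ B₃' a₀ a₁).τ9.M j' X) = true →
        Sect2.ofBackgroundC (settingOfRecord₁₃ F N (theta13OfThm1CCMW F N j γ ε₀ ε₂₉ B₃ B₃' a₀ a₁) p).ι (UbgOfRecord₁₃CoP F N (theta13OfThm1CCMW F N j γ ε₀ ε₂₉ B₃ B₃' a₀ a₁) p n s W) ∈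
          Sect2.spaceMS (settingOfRecord₁₃ F N (theta13OfThm1CCMW F N j γ ε₀ ε₂₉ B₃ B₃' a₀ a₁) p) ((theta13OfThm1CCMW F N j γ ε₀ ε₂₉ B₃ B₃' a₀ a₁).Rz p.K) (theta13OfThm1CCMW F N j γ ε₀ ε₂₉ B₃ B₃' a₀ a₁).τ9.M j' (Sect2.domSites (F.P p.K) (theta13OfThm1CCMW F N j γ ε₀ ε₂₉ B₃ B₃' a₀ a₁).τ9.M j' X) s.Ω) := by
  intro p n hn hw hpc s hsep W _ h7
  cases n with
  | zero => intro j' h1 hj'; exfalso; omega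
  | succ n =>
    rw [hseam]
    refine Stage13Params.bgAtDatumCoPB_of_thm1RegSepCoP7MGB_of_thm1GaugeGB_allTorus (theta13OfThm1CCMW F N j γ ε₀ ε₂₉ B₃ B₃' a₀ a₁)
      (admissible_theta13OfThm1CCMW_of_le_half F N hγ0 hγ hε hε' hB hB' ha₀ ha₁) rfl
      (τ9_M_pos_theta13OfThm1CCMW F N j γ ε₀ ε₂₉ B₃ B₃' a₀ a₁) h15 h15G (hnum_theta13OfThm1CCMW hγ hB hB' ha₀ ha₁) εreg_le_theta13OfThm1CCMW
      hcomp hcompRev (hBα_theta13OfThm1CCMW hγ hB hB' ha₀.le ha₁.le)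
      (htI_theta13OfThm1CCMW hγ hB hB' ha₀.le ha₁.le) (htMS_theta13OfThm1CCMW hγ hB hB' ha₀.le ha₁.le) (hC1_theta13OfThm1CCMW hγ) ⟨j, theta13OfThm1CCMW_τ9_M F N j γ ε₀ ε₂₉ B₃ B₃' a₀ a₁⟩
      (fun p' n' s' hn1 hn' hw' hpc' => ⟨?_, ?_, ?_, hpc'⟩) p (n + 1) hn hw hpc s hsep (M₁_pos_theta13OfThm1CCMW F N j γ ε₀ ε₂₉ B₃ B₃' a₀ a₁) W (hDat _ p (n + 1) s _ W hn hpc h7)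
    · rw [theta13OfThm1CCMW_M₁]; exact hc
    · -- the level letter at this torus-compatible run (the residue parent's §0 `succ_add_le_of_partCompat₁₃`, inlined — №365: no copy of a landed statement): `L^e ∣ 2·L^f ⇒ e ≤ f` for `L` odd `> 1`, from `PartCompat₁₃` ∧ (C1)
      obtain ⟨t, _, hR⟩ := (hC1_theta13OfThm1CCMW hγ) p' n' hn' hw' n' hn1 le_rfl
      have hdvd := hpc' n' hn1 le_rfl
      rw [hR, theta13OfThm1CCMW_τ9_M] at hdvd
      have hd : F.L ^ n' * F.L ^ j * (F.L * t) ∣ 2 * F.L ^ (F.m + p'.K - 0) := hdvd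
      rw [Nat.sub_zero] at hd
      have key : F.L ^ (n' + j + 1) ∣ 2 * F.L ^ (F.m + p'.K) := (Dvd.intro t (by ring) : F.L ^ (n' + j + 1) ∣ F.L ^ n' * F.L ^ j * (F.L * t)).trans hd
      have h := (Nat.pow_dvd_pow_iff_le_right F.hL.2).mp ((Nat.Coprime.pow_left (n' + j + 1) (Odd.coprime_two_right F.hL.1)).dvd_of_dvd_mul_left key)
      omega
    · rw [theta13OfThm1CCMW_τ9_M]; exact pow_dvd_pow F.L hc₁


end AtWitnessGridGuard

/-! ## §3  Closers under the CANDIDATE guard, (hcomp) ∧ (hcompRev), on EVERY family — p635083 §3 with the guard replaced (sentences over `(lamDatum F, Dat)`, `hDat` displayed) -/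

section ClosersGridGuard

variable {j c c₀ c₁ : ℕ} {γ ε₀ ε₂₉ B₃ B₃' a₀ a₁ : ℝ}

/-- **THE K0 BODY (⁵) FOR `F` AT `N = 2` AT `θ₁₅ᶜᶜᴹᵂ(j; γ)` UNDER THE CANDIDATE GUARD** (16a's socket ∘ the row above) — p635083 §3's first closer with the guard replaced.
CONDITIONAL; K0 NOT closed here. [cite: Balaban1985Variational, Thm 1 (8)–(9) p.279, Prop. 8 p.304; Balaban1988Convergent, Thm 1 p.262, (2.1) p.254, (2.4)–(2.8) pp.255–256, p.257; Balaban1987RG1, Thm 1 p.259, (0.1) p.251] -/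
theorem exists_k0SepCoP_thm1CCMW_gridGuard_of_thm1RegSepCoP7MG_of_thm1GaugeG_of_hcomp_allTorus (F : T4Family) {Dat : TopData F 2} (hγ0 : 0 < γ) (hγ : γ ≤ 1 / 2) (hε : 0 < ε₀) (hε' : 0 < ε₂₉) (hB : 0 ≤ B₃)
    (hB' : 0 ≤ B₃') (ha₀ : 0 < a₀) (ha₁ : 0 < a₁) (hc : c ≤ F.L ^ j) (hc₀ : c₀ ≤ j + 1) (hc₁ : c₁ ≤ j)
    (h15 : VariationalThm1RegSepCoP7MGB F 2 (fun ν M g K k _s => c ≤ ν.M₁ ∧ k + c₀ ≤ F.m + K ∧ F.L ^ c₁ ∣ M ∧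
      ∀ i, 1 ≤ i → i ≤ k → dCubeSide (F.P K).L M (RkOfRecord (F.P K).L ν.r (g i)) i ∣ (F.P K).sitesPerDir 0) (lamDatum F) Dat B₃ a₀ a₁)
    (h15G : VariationalThm1GaugeRegSepCoP7MGB F 2 (F.L ^ j) (fun ν M g K k _s => c ≤ ν.M₁ ∧ k + c₀ ≤ F.m + K ∧ F.L ^ c₁ ∣ M ∧
      ∀ i, 1 ≤ i → i ≤ k → dCubeSide (F.P K).L M (RkOfRecord (F.P K).L ν.r (g i)) i ∣ (F.P K).sitesPerDir 0) (lamDatum F) Dat B₃ B₃' a₀ a₁)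
    (hDat : ∀ (θ : Stage13Params F 2) (p : B12.RunParams) (n : ℕ) (s : SeqOfRecord F θ.ν θ.τ9.M (gOfRecord₁₃ F 2 θ p) p.K n) (δ : ℕ → ℝ) (W : MSField (F.P p.K) (SU 2)), n ≤ p.K → PartCompat₁₃ F 2 θ p n →
      Sect2.DataSmall7PTop (avOfRecord F 2 p.K) s.Ω (suppDomOfRecord F θ.ν p.K s.Ω) n δ W → Dat p.K s.Ω (suppDomOfRecord F θ.ν p.K s.Ω) n δ W)
    (hseam : ∀ (θ : Stage13Params F 2) (p : B12.RunParams) (n : ℕ) (s : SeqOfRecord F θ.ν θ.τ9.M (gOfRecord₁₃ F 2 θ p) p.K (n + 1)) (W : MSField (F.P p.K) (SU 2)),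
      UbgOfRecord₁₃CoP F 2 θ p (n + 1) s W = UbgMSCoPOfRecordB F 2 θ.ν θ.τ9.M (gOfRecord₁₃ F 2 θ p) p.K (n + 1) s W)
    (hcomp : ∀ (p : B12.RunParams) (n : ℕ), n ≤ p.K → Step.InInterval (theta13OfThm1CCMW F 2 j γ ε₀ ε₂₉ B₃ B₃' a₀ a₁).γ n (gOfRecord₁₃ F 2 (theta13OfThm1CCMW F 2 j γ ε₀ ε₂₉ B₃ B₃' a₀ a₁) p) → ∀ m, m < n →
      (theta13OfThm1CCMW F 2 j γ ε₀ ε₂₉ B₃ B₃' a₀ a₁).s2.cR * epsOfRecord (theta13OfThm1CCMW F 2 j γ ε₀ ε₂₉ B₃ B₃' a₀ a₁).ν (gOfRecord₁₃ F 2 (theta13OfThm1CCMW F 2 j γ ε₀ ε₂₉ B₃ B₃' a₀ a₁) p) m ≤ 2 * ((theta13OfThm1CCMW F 2 j γ ε₀ ε₂₉ B₃ B₃' a₀ a₁).s2.cR * epsOfRecord (theta13OfThm1CCMW F 2 j γ ε₀ ε₂₉ B₃ B₃' a₀ a₁).ν (gOfRecord₁₃ F 2 (theta13OfThm1CCMW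 F 2 j γ ε₀ ε₂₉ B₃ B₃' a₀ a₁) p) (m + 1)))
    (hcompRev : ∀ (p : B12.RunParams) (n : ℕ), n ≤ p.K → Step.InInterval (theta13OfThm1CCMW F 2 j γ ε₀ ε₂₉ B₃ B₃' a₀ a₁).γ n (gOfRecord₁₃ F 2 (theta13OfThm1CCMW F 2 j γ ε₀ ε₂₉ B₃ B₃' a₀ a₁) p) → ∀ m, m < n →
      (theta13OfThm1CCMW F 2 j γ ε₀ ε₂₉ B₃ B₃' a₀ a₁).s2.cR * epsOfRecord (theta13OfThm1CCMW F 2 j γ ε₀ ε₂₉ B₃ B₃' a₀ a₁).ν (gOfRecord₁₃ F 2 (theta13OfThm1CCMW F 2 j γ ε₀ ε₂₉ B₃ B₃' a₀ a₁) p) (m + 1) ≤ 2 * ((theta13OfThm1CCMW F 2 j γ ε₀ ε₂₉ B₃ B₃' a₀ a₁).s2.cR * epsOfRecord (theta13OfThm1CCMW F 2 j γ ε₀ ε₂₉ B₃ B₃' a₀ a₁).ν (gOfRecord₁₃ F 2 (theta13OfThm1CCMW F 2 j γ ε₀ ε₂₉ B₃ B₃' a₀ a₁) p) m)) :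
    ∃ θ : Stage13Params F 2, θ.Provisos₁₃SepCoP F 2 ∧ (θ.ZtUnity F 2 ∧ θ.SlotsNondegenerate₁₃ F 2) ∧ θ.Admissible F 2 :=
  exists_k0SepCoP_of_bgSepCoP_theta13LiveOfNumerics F (stage12NumericsOfThm1CCMW_pos_of_le_half (L := F.L) (j := j) F.hL.2.le hγ0 hγ hε hB hB' ha₀ ha₁) hε' ⟨j, rfl⟩ (dvd_refl _)
    (bgSepCoPAt_theta13OfThm1CCMW_gridGuard_of_thm1RegSepCoP7MG_of_thm1GaugeG_of_hcomp_allTorus hγ0 hγ hε hε' hB hB' ha₀ ha₁ hc hc₀ hc₁ h15 h15G hDat hseam hcomp hcompRev)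

/-- **THE ⁷ IMAGE, ON EVERY FAMILY, UNDER THE CANDIDATE GUARD** (FILE 18's cured lift, T's history-blind door) — p635083 §3's second closer with the guard replaced.  CONDITIONAL.
[cite: Balaban1985Variational, Thm 1 (8) p.279, Prop. 8 p.304; Balaban1988Convergent, Thm 1 p.262, (2.1) p.254, (2.21) p.258; Balaban1989LargeFieldI, (0.2)–(0.4) p.176] -/
theorem exists_k0SepCoPH_thm1CCMW_gridGuard_of_thm1RegSepCoP7MG_of_thm1GaugeG_of_hcomp_allTorus (F : T4Family) {Dat : TopData F 2} (hγ0 : 0 < γ) (hγ : γ ≤ 1 / 2) (hε : 0 < ε₀) (hε' : 0 < ε₂₉) (hB : 0 ≤ B₃)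
    (hB' : 0 ≤ B₃') (ha₀ : 0 < a₀) (ha₁ : 0 < a₁) (hc : c ≤ F.L ^ j) (hc₀ : c₀ ≤ j + 1) (hc₁ : c₁ ≤ j)
    (h15 : VariationalThm1RegSepCoP7MGB F 2 (fun ν M g K k _s => c ≤ ν.M₁ ∧ k + c₀ ≤ F.m + K ∧ F.L ^ c₁ ∣ M ∧
      ∀ i, 1 ≤ i → i ≤ k → dCubeSide (F.P K).L M (RkOfRecord (F.P K).L ν.r (g i)) i ∣ (F.P K).sitesPerDir 0) (lamDatum F) Dat B₃ a₀ a₁)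
    (h15G : VariationalThm1GaugeRegSepCoP7MGB F 2 (F.L ^ j) (fun ν M g K k _s => c ≤ ν.M₁ ∧ k + c₀ ≤ F.m + K ∧ F.L ^ c₁ ∣ M ∧
      ∀ i, 1 ≤ i → i ≤ k → dCubeSide (F.P K).L M (RkOfRecord (F.P K).L ν.r (g i)) i ∣ (F.P K).sitesPerDir 0) (lamDatum F) Dat B₃ B₃' a₀ a₁)
    (hDat : ∀ (θ : Stage13Params F 2) (p : B12.RunParams) (n : ℕ) (s : SeqOfRecord F θ.ν θ.τ9.M (gOfRecord₁₃ F 2 θ p) p.K n) (δ : ℕ → ℝ) (W : MSField (F.P p.K) (SU 2)), n ≤ p.K → PartCompat₁₃ F 2 θ p n →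
      Sect2.DataSmall7PTop (avOfRecord F 2 p.K) s.Ω (suppDomOfRecord F θ.ν p.K s.Ω) n δ W → Dat p.K s.Ω (suppDomOfRecord F θ.ν p.K s.Ω) n δ W)
    (hseam : ∀ (θ : Stage13Params F 2) (p : B12.RunParams) (n : ℕ) (s : SeqOfRecord F θ.ν θ.τ9.M (gOfRecord₁₃ F 2 θ p) p.K (n + 1)) (W : MSField (F.P p.K) (SU 2)),
      UbgOfRecord₁₃CoP F 2 θ p (n + 1) s W = UbgMSCoPOfRecordB F 2 θ.ν θ.τ9.M (gOfRecord₁₃ F 2 θ p) p.K (n + 1) s W)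
    (hcomp : ∀ (p : B12.RunParams) (n : ℕ), n ≤ p.K → Step.InInterval (theta13OfThm1CCMW F 2 j γ ε₀ ε₂₉ B₃ B₃' a₀ a₁).γ n (gOfRecord₁₃ F 2 (theta13OfThm1CCMW F 2 j γ ε₀ ε₂₉ B₃ B₃' a₀ a₁) p) → ∀ m, m < n →
      (theta13OfThm1CCMW F 2 j γ ε₀ ε₂₉ B₃ B₃' a₀ a₁).s2.cR * epsOfRecord (theta13OfThm1CCMW F 2 j γ ε₀ ε₂₉ B₃ B₃' a₀ a₁).ν (gOfRecord₁₃ F 2 (theta13OfThm1CCMW F 2 j γ ε₀ ε₂₉ B₃ B₃' a₀ a₁) p) m ≤ 2 * ((theta13OfThm1CCMW F 2 j γ ε₀ ε₂₉ B₃ B₃' a₀ a₁).s2.cR * epsOfRecord (theta13OfThm1CCMW F 2 j γ ε₀ ε₂₉ B₃ B₃' a₀ a₁).ν (gOfRecord₁₃ F 2 (theta13OfThm1CCMW F 2 j γ ε₀ ε₂₉ B₃ B₃' a₀ a₁) p) (m + 1)))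
    (hcompRev : ∀ (p : B12.RunParams) (n : ℕ), n ≤ p.K → Step.InInterval (theta13OfThm1CCMW F 2 j γ ε₀ ε₂₉ B₃ B₃' a₀ a₁).γ n (gOfRecord₁₃ F 2 (theta13OfThm1CCMW F 2 j γ ε₀ ε₂₉ B₃ B₃' a₀ a₁) p) → ∀ m, m < n →
      (theta13OfThm1CCMW F 2 j γ ε₀ ε₂₉ B₃ B₃' a₀ a₁).s2.cR * epsOfRecord (theta13OfThm1CCMW F 2 j γ ε₀ ε₂₉ B₃ B₃' a₀ a₁).ν (gOfRecord₁₃ F 2 (theta13OfThm1CCMW F 2 j γ ε₀ ε₂₉ B₃ B₃' a₀ a₁) p) (m + 1) ≤ 2 * ((theta13OfThm1CCMW F 2 j γ ε₀ ε₂₉ B₃ B₃' a₀ a₁).s2.cR * epsOfRecord (theta13OfThm1CCMW F 2 j γ ε₀ ε₂₉ B₃ B₃' a₀ a₁).ν (gOfRecord₁₃ F 2 (theta13OfThm1CCMW F 2 j γ ε₀ ε₂₉ B₃ B₃' a₀ a₁) p) m)) :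
    ∃ θ : Stage13HParams F 2, θ.Provisos₁₃SepCoPH F 2 ∧ (θ.ZhUnity F 2 ∧ θ.SlotsNondegenerate₁₃ F 2) ∧ θ.Admissible F 2 :=
  exists_k0SepCoPH_of_exists_k0SepCoPR (exists_k0SepCoPR_of_exists_k0SepCoP F
    (exists_k0SepCoP_thm1CCMW_gridGuard_of_thm1RegSepCoP7MG_of_thm1GaugeG_of_hcomp_allTorus F hγ0 hγ hε hε' hB hB' ha₀ ha₁ hc hc₀ hc₁ h15 h15G hDat hseam hcomp hcompRev))

/-- **★★ THE ⁷ K0 BODY KEYED ON THE GUARDED (8) AND THE GUARDED (9)-STEP FACT AT `(L^j, Adm)` UNDER THE CANDIDATE GUARD, ON EVERY FAMILY** (dag-n07-e module 51's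
`variationalThm1GaugeRegSepCoP7MG_of_gauge9TopStepG`; here its `(bd, Dat)` twin S1b-2 `variationalThm1GaugeRegSepCoP7MGB_of_gauge9TopStepGB`) — p635083 §3's third closer with the
guard replaced: the K0 body CLOSES under the four-conjunct candidate exactly as under V20-G.  CONDITIONAL; the candidate is NOT a registered text.
[cite: Balaban1985Variational, Thm 1 (8)–(9) p.279, (144)–(152) pp.300–301, Prop. 8 p.304; Balaban1988Convergent, Thm 1 p.262, (2.1) p.254, (2.21) p.258, p.257; Balaban1989LargeFieldI, (0.2)–(0.4) p.176] -/
theorem exists_k0SepCoPH_thm1CCMW_gridGuard_of_thm1RegSepCoP7MG_of_gauge9TopStepG_of_hcomp_allTorus (F : T4Family) {Dat : TopData F 2} (hγ0 : 0 < γ) (hγ : γ ≤ 1 / 2) (hε : 0 < ε₀) (hε' : 0 < ε₂₉)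
    (hB : 0 ≤ B₃) (hB' : 0 ≤ B₃') (ha₀ : 0 < a₀) (ha₁ : 0 < a₁) (hc : c ≤ F.L ^ j) (hc₀ : c₀ ≤ j + 1) (hc₁ : c₁ ≤ j)
    (h15 : VariationalThm1RegSepCoP7MGB F 2 (fun ν M g K k _s => c ≤ ν.M₁ ∧ k + c₀ ≤ F.m + K ∧ F.L ^ c₁ ∣ M ∧
      ∀ i, 1 ≤ i → i ≤ k → dCubeSide (F.P K).L M (RkOfRecord (F.P K).L ν.r (g i)) i ∣ (F.P K).sitesPerDir 0) (lamDatum F) Dat B₃ a₀ a₁)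
    (h9 : Gauge9RegSepTopStepGB F 2 (fun ν K Ω => suppDomOfRecord F ν K Ω) (F.L ^ j) (fun ν M g K k _s => c ≤ ν.M₁ ∧ k + c₀ ≤ F.m + K ∧ F.L ^ c₁ ∣ M ∧
      ∀ i, 1 ≤ i → i ≤ k → dCubeSide (F.P K).L M (RkOfRecord (F.P K).L ν.r (g i)) i ∣ (F.P K).sitesPerDir 0) (lamDatum F) Dat B₃ B₃' a₀ a₁)
    (hDat : ∀ (θ : Stage13Params F 2) (p : B12.RunParams) (n : ℕ) (s : SeqOfRecord F θ.ν θ.τ9.M (gOfRecord₁₃ F 2 θ p) p.K n) (δ : ℕ → ℝ) (W : MSField (F.P p.K) (SU 2)), n ≤ p.K → PartCompat₁₃ F 2 θ p n →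
      Sect2.DataSmall7PTop (avOfRecord F 2 p.K) s.Ω (suppDomOfRecord F θ.ν p.K s.Ω) n δ W → Dat p.K s.Ω (suppDomOfRecord F θ.ν p.K s.Ω) n δ W)
    (hseam : ∀ (θ : Stage13Params F 2) (p : B12.RunParams) (n : ℕ) (s : SeqOfRecord F θ.ν θ.τ9.M (gOfRecord₁₃ F 2 θ p) p.K (n + 1)) (W : MSField (F.P p.K) (SU 2)),
      UbgOfRecord₁₃CoP F 2 θ p (n + 1) s W = UbgMSCoPOfRecordB F 2 θ.ν θ.τ9.M (gOfRecord₁₃ F 2 θ p) p.K (n + 1) s W)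
    (hcomp : ∀ (p : B12.RunParams) (n : ℕ), n ≤ p.K → Step.InInterval (theta13OfThm1CCMW F 2 j γ ε₀ ε₂₉ B₃ B₃' a₀ a₁).γ n (gOfRecord₁₃ F 2 (theta13OfThm1CCMW F 2 j γ ε₀ ε₂₉ B₃ B₃' a₀ a₁) p) → ∀ m, m < n →
      (theta13OfThm1CCMW F 2 j γ ε₀ ε₂₉ B₃ B₃' a₀ a₁).s2.cR * epsOfRecord (theta13OfThm1CCMW F 2 j γ ε₀ ε₂₉ B₃ B₃' a₀ a₁).ν (gOfRecord₁₃ F 2 (theta13OfThm1CCMW F 2 j γ ε₀ ε₂₉ B₃ B₃' a₀ a₁) p) m ≤ 2 * ((theta13OfThm1CCMW F 2 j γ ε₀ ε₂₉ B₃ B₃' a₀ a₁).s2.cR * epsOfRecord (theta13OfThm1CCMW F 2 j γ ε₀ ε₂₉ B₃ B₃' a₀ a₁).ν (gOfRecord₁₃ F 2 (theta13OfThm1CCMW F 2 j γ ε₀ ε₂₉ B₃ B₃' a₀ a₁) p) (m + 1)))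
    (hcompRev : ∀ (p : B12.RunParams) (n : ℕ), n ≤ p.K → Step.InInterval (theta13OfThm1CCMW F 2 j γ ε₀ ε₂₉ B₃ B₃' a₀ a₁).γ n (gOfRecord₁₃ F 2 (theta13OfThm1CCMW F 2 j γ ε₀ ε₂₉ B₃ B₃' a₀ a₁) p) → ∀ m, m < n →
      (theta13OfThm1CCMW F 2 j γ ε₀ ε₂₉ B₃ B₃' a₀ a₁).s2.cR * epsOfRecord (theta13OfThm1CCMW F 2 j γ ε₀ ε₂₉ B₃ B₃' a₀ a₁).ν (gOfRecord₁₃ F 2 (theta13OfThm1CCMW F 2 j γ ε₀ ε₂₉ B₃ B₃' a₀ a₁) p) (m + 1) ≤ 2 * ((theta13OfThm1CCMW F 2 j γ ε₀ ε₂₉ B₃ B₃' a₀ a₁).s2.cR * epsOfRecord (theta13OfThm1CCMW F 2 j γ ε₀ ε₂₉ B₃ B₃' a₀ a₁).ν (gOfRecord₁₃ F 2 (theta13OfThm1CCMW F 2 j γ ε₀ ε₂₉ B₃ B₃' a₀ a₁) p) m)) :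
    ∃ θ : Stage13HParams F 2, θ.Provisos₁₃SepCoPH F 2 ∧ (θ.ZhUnity F 2 ∧ θ.SlotsNondegenerate₁₃ F 2) ∧ θ.Admissible F 2 :=
  exists_k0SepCoPH_thm1CCMW_gridGuard_of_thm1RegSepCoP7MG_of_thm1GaugeG_of_hcomp_allTorus F hγ0 hγ hε hε' hB hB' ha₀ ha₁ hc hc₀ hc₁ h15
    (variationalThm1GaugeRegSepCoP7MGB_of_gauge9TopStepGB h9) hDat hseam hcomp hcompRev


/-- **★★ THE ⁷ K0 BODY FROM THE (8)-STEP SENTENCE UNDER THE CANDIDATE GUARD OVER PRINT's DATUM** — what a V23-type stub 1 displays (`Prop8RegSepTopStepGB F 2 suppDom Adm (lamDatum F)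
Dat B₃ a₀ a₁` at the four-conjunct `Adm`), through 53′'s guard-generic bridge `variationalThm1RegSepCoP7MGB_of_prop8TopStepGB_lamDatum` (dag-n07-e module 53 ∕ k0-s1-w1) and the closer above.
CONDITIONAL on the two sentences and `hDat`; NOT a registered text; K0⁷ OPEN. [cite: Balaban1985Variational, Thm 1 (8)–(9) p.279, Prop. 8 p.304, p.304 lines 1–2; Balaban1988Convergent, Thm 1 p.262, (2.1) p.254, p.257; Balaban1987RG1, (0.1) p.251] -/
theorem exists_k0SepCoPH_thm1CCMW_gridGuard_of_prop8TopStepG_of_gauge9TopStepG_of_hcomp_allTorus (F : T4Family) {Dat : TopData F 2} (hγ0 : 0 < γ) (hγ : γ ≤ 1 / 2) (hε : 0 < ε₀) (hε' : 0 < ε₂₉)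
    (hB : 0 < B₃) (hB' : 0 ≤ B₃') (ha₀ : 0 < a₀) (ha₁ : 0 < a₁) (hc : c ≤ F.L ^ j) (hc₀ : c₀ ≤ j + 1) (hc₁ : c₁ ≤ j)
    (h8 : Prop8RegSepTopStepGB F 2 (fun ν K Ω => suppDomOfRecord F ν K Ω) (fun ν M g K k _s => c ≤ ν.M₁ ∧ k + c₀ ≤ F.m + K ∧ F.L ^ c₁ ∣ M ∧
      ∀ i, 1 ≤ i → i ≤ k → dCubeSide (F.P K).L M (RkOfRecord (F.P K).L ν.r (g i)) i ∣ (F.P K).sitesPerDir 0) (lamDatum F) Dat B₃ a₀ a₁)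
    (h9 : Gauge9RegSepTopStepGB F 2 (fun ν K Ω => suppDomOfRecord F ν K Ω) (F.L ^ j) (fun ν M g K k _s => c ≤ ν.M₁ ∧ k + c₀ ≤ F.m + K ∧ F.L ^ c₁ ∣ M ∧
      ∀ i, 1 ≤ i → i ≤ k → dCubeSide (F.P K).L M (RkOfRecord (F.P K).L ν.r (g i)) i ∣ (F.P K).sitesPerDir 0) (lamDatum F) Dat B₃ B₃' a₀ a₁)
    (hDat : ∀ (θ : Stage13Params F 2) (p : B12.RunParams) (n : ℕ) (s : SeqOfRecord F θ.ν θ.τ9.M (gOfRecord₁₃ F 2 θ p) p.K n) (δ : ℕ → ℝ) (W : MSField (F.P p.K) (SU 2)), n ≤ p.K → PartCompat₁₃ F 2 θ p n →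
      Sect2.DataSmall7PTop (avOfRecord F 2 p.K) s.Ω (suppDomOfRecord F θ.ν p.K s.Ω) n δ W → Dat p.K s.Ω (suppDomOfRecord F θ.ν p.K s.Ω) n δ W)
    (hseam : ∀ (θ : Stage13Params F 2) (p : B12.RunParams) (n : ℕ) (s : SeqOfRecord F θ.ν θ.τ9.M (gOfRecord₁₃ F 2 θ p) p.K (n + 1)) (W : MSField (F.P p.K) (SU 2)),
      UbgOfRecord₁₃CoP F 2 θ p (n + 1) s W = UbgMSCoPOfRecordB F 2 θ.ν θ.τ9.M (gOfRecord₁₃ F 2 θ p) p.K (n + 1) s W)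
    (hcomp : ∀ (p : B12.RunParams) (n : ℕ), n ≤ p.K → Step.InInterval (theta13OfThm1CCMW F 2 j γ ε₀ ε₂₉ B₃ B₃' a₀ a₁).γ n (gOfRecord₁₃ F 2 (theta13OfThm1CCMW F 2 j γ ε₀ ε₂₉ B₃ B₃' a₀ a₁) p) → ∀ m, m < n →
      (theta13OfThm1CCMW F 2 j γ ε₀ ε₂₉ B₃ B₃' a₀ a₁).s2.cR * epsOfRecord (theta13OfThm1CCMW F 2 j γ ε₀ ε₂₉ B₃ B₃' a₀ a₁).ν (gOfRecord₁₃ F 2 (theta13OfThm1CCMW F 2 j γ ε₀ ε₂₉ B₃ B₃' a₀ a₁) p) m ≤ 2 * ((theta13OfThm1CCMW F 2 j γ ε₀ ε₂₉ B₃ B₃' a₀ a₁).s2.cR * epsOfRecord (theta13OfThm1CCMW F 2 j γ ε₀ ε₂₉ B₃ B₃' a₀ a₁).ν (gOfRecord₁₃ F 2 (theta13OfThm1CCMW F 2 j γ ε₀ ε₂₉ B₃ B₃' a₀ a₁) p) (m + 1)))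
    (hcompRev : ∀ (p : B12.RunParams) (n : ℕ), n ≤ p.K → Step.InInterval (theta13OfThm1CCMW F 2 j γ ε₀ ε₂₉ B₃ B₃' a₀ a₁).γ n (gOfRecord₁₃ F 2 (theta13OfThm1CCMW F 2 j γ ε₀ ε₂₉ B₃ B₃' a₀ a₁) p) → ∀ m, m < n →
      (theta13OfThm1CCMW F 2 j γ ε₀ ε₂₉ B₃ B₃' a₀ a₁).s2.cR * epsOfRecord (theta13OfThm1CCMW F 2 j γ ε₀ ε₂₉ B₃ B₃' a₀ a₁).ν (gOfRecord₁₃ F 2 (theta13OfThm1CCMW F 2 j γ ε₀ ε₂₉ B₃ B₃' a₀ a₁) p) (m + 1) ≤ 2 * ((theta13OfThm1CCMW F 2 j γ ε₀ ε₂₉ B₃ B₃' a₀ a₁).s2.cR * epsOfRecord (theta13OfThm1CCMW F 2 j γ ε₀ ε₂₉ B₃ B₃' a₀ a₁).ν (gOfRecord₁₃ F 2 (theta13OfThm1CCMW F 2 j γ ε₀ ε₂₉ B₃ B₃' a₀ a₁) p) m)) :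
    ∃ θ : Stage13HParams F 2, θ.Provisos₁₃SepCoPH F 2 ∧ (θ.ZhUnity F 2 ∧ θ.SlotsNondegenerate₁₃ F 2) ∧ θ.Admissible F 2 :=
  exists_k0SepCoPH_thm1CCMW_gridGuard_of_thm1RegSepCoP7MG_of_gauge9TopStepG_of_hcomp_allTorus F hγ0 hγ hε hε' hB.le hB' ha₀ ha₁ hc hc₀ hc₁
    (variationalThm1RegSepCoP7MGB_of_prop8TopStepGB_lamDatum hB h8) h9 hDat hseam hcomp hcompRev

end ClosersGridGuard

end Summit.QuantumFields.YangMills.Theorems.K0Stub1GridNumericsGuardWitnessB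

end
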